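import Mathlib.Analysis.Calculus.Deriv.MeanValue
import Literature.MathematicalPhysics.QuantumLattice.ApproximatingHamiltonian
import Literature.MathematicalPhysics.QuantumLattice.DuhamelTwoPointProofs
import Literature.MathematicalPhysics.QuantumLattice.TraceInequalitiesProofs
import HarnessLib

/-!
# The approximating Hamiltonian method for an attractive channel: proofs

Sibling proof file of `ApproximatingHamiltonian.lean` (trunk: quantum lattice systems; consumer:
the Hubbard routes `ThermalWedge`, `DeformationLadder`). No definition and no statement is
introduced or changed here; this file **discharges the named fact**
`Literature.MathematicalPhysics.QuantumLattice.bogoliubovJr_approximatingHamiltonian_attractive`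
(`…_holds`): Theorem 107 (i)–(ii) of the appendix "The approximating Hamiltonian method" of
Bru–de Siqueira Pedra, Mem. AMS 224 (2013) no. 1052 (= Bogolyubov Jr.–Brankov–Zagrebnov–
Kurbatov–Tonchev, Russ. Math. Surveys 39:6 (1984)), for ONE attractive separable channel
`H_Λ = T_Λ - |Λ|⁻¹ U⋆U` on finite-dimensional boxes: the approximating free energy
`c ↦ |c|² - p[T - (c̄U + cU⋆)]` attains its infimum at some `d_Λ`, and
`p[H_Λ] - (p[H_Λ(d_Λ)] - |d_Λ|²) → 0` as `|Λ| → ∞`, under (A2)–(A3) (the printed (A1) and the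
ergodicity condition (A4) are carried by the fact but not needed: Bru–Pedra, Remark 34, "(A4) is
used … to handle the positive part").

Bru–Pedra print the statement only ("Bogoliubov Jr. et al. have shown [BBZKT 1984] the following
…  The proof of this theorem uses as a key ingredient the Bogoliubov (convexity) inequality …
Another important technique used by the authors are the Ginibre inequalities"). The proof
formalised here is Bogolyubov Jr.'s majorisation method (1966/1972) in a finite-dimensional
rendering built on the tree's thermal toolkit (`DuhamelTwoPoint.lean`: Peierls–Bogoliubov
inequality, Duhamel two-point function, Falk–Bruch inequality; `DuhamelTwoPointProofs.lean`:
Duhamel's derivative formula; `TraceInequalitiesProofs.lean`: `|Tr(OP)| ≤ ‖O‖ Tr P`):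

* **Toolkit** (`log Z = log Tr e^{-βH}`): the Bogoliubov convexity inequality
  `log Z(H) - β⟨W⟩_H ≤ log Z(H + W)` (`log_partitionFn_sub_le_log_partitionFn_add`), hence the
  Lipschitz bound `|log Z(H₁) - log Z(H₂)| ≤ β‖H₁ - H₂‖`, monotonicity, scalar shifts; states are
  bounded by the operator norm; the Duhamel function of a centred observable
  `(A - c, A - c) = (A, A) - 2c⟨A⟩ + c²`.
* **Sources**: for Hermitian `H`, `A` the magnetisation `m(s) = ⟨A⟩_{H - sA}` has derivative
  `β((A,A)_{H-sA} - m(s)²)` (`hasDerivAt_re_gibbsState_source`, Duhamel's formula); since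
  `|m| ≤ ‖A‖`, the mean value theorem on `(-r, r)` yields a source `s` with Duhamel variance
  `≤ ‖A‖/(βr)` (`exists_source_duhamel_var_le`) — this replaces the averaging over sources
  (Gauss' theorem on a disc of sources) of the printed method.
* **One Hermitian attractive channel** (`log_partitionFn_oneChannel_le`): for Hermitian `K, A`
  with `‖A‖ ≤ CV`, `‖[A,[A,K]]‖ ≤ κV`, there is `x`, `|x| ≤ C`, with
  `log Z(K - V⁻¹A²) ≤ log Z(K - 2xA) - βVx² + 2βrCV + C/r + (β/2)√(Cκ/r)`: source on (cost
  `βrCV`), Bogoliubov's inequality at the sourced Hamiltonian `Γ` with the completed square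
  `Γ + V⁻¹(A - ⟨A⟩_Γ)² = K - 2xA - sA + x²V`, `x = ⟨A⟩_Γ/V`, the fluctuation
  `V⁻¹⟨(A - ⟨A⟩)²⟩_Γ` bounded by the Falk–Bruch inequality through the Duhamel variance and the
  double commutator `[A,[A,K]]` (functions of `A` drop out of `[Γ, A]`), source off.
* **One complex channel** `U = A₁ + iA₂`, `A₁ = (U + U⋆)/2`, `A₂ = i(U⋆ - U)/2`
  (`log_partitionFn_twoChannel_le`, `exists_pressure_model_le`): `U⋆U = A₁² + A₂² + i[A₁,A₂]`
  with `‖V⁻¹ i[A₁,A₂]‖ ≤ C₂/2`, so after a Lipschitz step the two Hermitian channels are treated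
  successively (kinetic parts `T - V⁻¹A₁²`, then `T - 2yA₂`); the commutator hypotheses (A3) on
  `U, U⋆, T` translate to the pair by bilinearity and `[X,[Y,T]]⋆ = [X⋆,[Y⋆,T]]`. Result:
  `p[H_Λ] ≤ p[H_Λ(c)] - |c|² + 4rC₁ + Q(r)/V` for every `r > 0`, with `Q(r)` independent of `V`.
* **Lower bound and (i)**: `H_Λ(c) + |c|²V - H_Λ = V⁻¹(U - cV)⋆(U - cV) ≥ 0`
  (`log_partitionFn_approx_le_model`); the maximiser exists by continuity and the coercivity
  bound `p[H(c)] ≤ p[T] + 2|c|‖U‖/V` (`exists_isMax_approx`).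
* **(ii)**: `0 ≤ p[H_l] - max_c (p[H_l(c)] - |c|²) ≤ 4rC₁ + Q(r)/vol_l` for all `r > 0` and
  `vol_l → ∞` give the limit `0` (boxes with `d_l = 0` have all pressures `0`).

## References

* J.-B. Bru, W. de Siqueira Pedra, *Non-cooperative equilibria of Fermi systems with long range
  interactions*, Mem. Amer. Math. Soc. 224 (2013), no. 1052, Appendix, §"The approximating
  Hamiltonian method": conditions (A1)–(A5), Theorem 107, Remarks 34–35 [BruPedra2013]
  (held: arXiv:1902.08047, pp. 120–121 of the materialised text).
* N. N. Bogolyubov Jr., J. G. Brankov, V. A. Zagrebnov, A. M. Kurbatov, N. S. Tonchev, *Some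
  classes of exactly soluble models of problems in quantum statistical mechanics: the method of
  the approximating Hamiltonian*, Russ. Math. Surveys 39:6 (1984) 1–50 [BogolyubovJrEtAl1984]
  (the original proof; cited through [BruPedra2013], not re-read here).
* F. J. Dyson, E. H. Lieb, B. Simon, J. Stat. Phys. 18 (1978) 335–383, §3 (Falk–Bruch
  inequality, Duhamel two-point function) — through `DuhamelTwoPoint.lean`.

## Design notes

* Everything is over `ℂ`, for a general finite index type `n` (`[Fintype n] [DecidableEq n]`,
  `[Nonempty n]` where a positive partition function is needed); the fact itself is about
  `Fin (d l)` and the empty box is treated separately in the final assembly.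
* Free energies are handled as `Real.log (Matrix.partitionFn β H).re` (extensive units) up to the
  last step, where `AHM.pressure β V H = log Z / (βV)` is definitionally unfolded.
* Commutators are written with the ring bracket `⁅X, Y⁆ = X * Y - Y * X` (`Ring.lie_def`, which
  is `rfl`, so the product form of (A3) in the fact matches syntactically); matrices carry no
  `LieRing` instance at this Mathlib pin, so bilinearity is done by `simp [Ring.lie_def, …]` and
  `module`.
* The `L2Operator` matrix norm scope of `FinDimSpectrum.lean` is used throughout (C⋆-norm:
  `‖Aᴴ‖ = ‖A‖`, `‖AB‖ ≤ ‖A‖‖B‖`).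
-/

noncomputable section

open scoped Matrix.Norms.L2Operator ComplexOrder Topology
open Matrix Filter Finset MeasureTheory intervalIntegral NormedSpace

namespace Literature.MathematicalPhysics.QuantumLattice

variable {n : Type*} [Fintype n] [DecidableEq n]

section Toolkit

variable {H : Matrix n n ℂ}

/-- `Z` is real: `Z = (Re Z : ℂ)` for a Hermitian Hamiltonian. [folklore] -/
theorem partitionFn_eq_re (hH : H.IsHermitian) (β : ℝ) :
    partitionFn β H = ((partitionFn β H).re : ℂ) := by
  rw [hH.partitionFn_eq_ofReal, Complex.ofReal_re]

/-- `Re Z > 0` on a nonempty index type. [folklore] -/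
theorem partitionFn_re_pos (hH : H.IsHermitian) [Nonempty n] (β : ℝ) :
    0 < (partitionFn β H).re := by
  rw [hH.partitionFn_eq_ofReal, Complex.ofReal_re]; exact hH.sum_exp_pos β

/-- **States are bounded by the operator norm**: `‖⟨O⟩_β‖ ≤ ‖O‖` for the Gibbs state of a
Hermitian Hamiltonian (`|Tr(O P)| ≤ ‖O‖ Tr P` for `P = e^{-βH} ≥ 0`). [folklore] -/
theorem norm_gibbsState_le (hH : H.IsHermitian) [Nonempty n] (β : ℝ) (O : Matrix n n ℂ) :
    ‖gibbsState β H O‖ ≤ ‖O‖ := by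
  have hZre : 0 < (partitionFn β H).re := partitionFn_re_pos hH β
  have hZn : ‖partitionFn β H‖ = (partitionFn β H).re := by
    rw [partitionFn_eq_re hH β, Complex.norm_real, Real.norm_of_nonneg hZre.le, Complex.ofReal_re]
  have key := norm_trace_mul_le_opNorm_mul_re_trace O (posDef_gibbsWeight β hH).posSemidef
  rw [gibbsState_apply, norm_mul, norm_inv, hZn, inv_mul_le_iff₀ hZre, trace_mul_comm, mul_comm]
  exact key

/-- `|Re ⟨O⟩_β| ≤ ‖O‖`. [folklore] -/
theorem abs_re_gibbsState_le (hH : H.IsHermitian) [Nonempty n] (β : ℝ) (O : Matrix n n ℂ) :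
    |(gibbsState β H O).re| ≤ ‖O‖ :=
  (Complex.abs_re_le_norm _).trans (norm_gibbsState_le hH β O)

/-- The Gibbs expectation of a Hermitian observable is real. [folklore] -/
theorem gibbsState_eq_re (hH : H.IsHermitian) (β : ℝ) {A : Matrix n n ℂ} (hA : A.IsHermitian) :
    gibbsState β H A = ((gibbsState β H A).re : ℂ) := by
  have h := gibbsState_conjTranspose β hH A
  rw [hA.eq, Complex.star_def] at h
  exact (Complex.conj_eq_iff_re.mp h.symm).symm

/-- **Peierls–Bogoliubov in logarithmic form**: `log Z(H) - β Re⟨W⟩_H ≤ log Z(H + W)` for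
Hermitian `H`, `W` (the Bogoliubov convexity inequality for the free energy). [folklore] -/
theorem log_partitionFn_sub_le_log_partitionFn_add (hH : H.IsHermitian) {W : Matrix n n ℂ}
    (hW : W.IsHermitian) [Nonempty n] (β : ℝ) :
    Real.log (partitionFn β H).re - β * (gibbsState β H W).re ≤
      Real.log (partitionFn β (H + W)).re := by
  have h := peierls_bogoliubov hH hW β
  have hZ := partitionFn_re_pos hH β
  have h2 : Real.log ((partitionFn β H).re * Real.exp (-(β * (gibbsState β H W).re))) ≤
      Real.log (partitionFn β (H + W)).re :=
    Real.log_le_log (mul_pos hZ (Real.exp_pos _)) h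
  rw [Real.log_mul hZ.ne' (Real.exp_pos _).ne', Real.log_exp] at h2
  linarith

/-- **Lipschitz bound for the free energy**: `log Z(H₁) - log Z(H₂) ≤ β ‖H₂ - H₁‖` for Hermitian
`H₁`, `H₂` and `β ≥ 0`. [folklore] -/
theorem log_partitionFn_sub_log_partitionFn_le {H₁ H₂ : Matrix n n ℂ} (hH₁ : H₁.IsHermitian)
    (hH₂ : H₂.IsHermitian) [Nonempty n] {β : ℝ} (hβ : 0 ≤ β) :
    Real.log (partitionFn β H₁).re - Real.log (partitionFn β H₂).re ≤ β * ‖H₂ - H₁‖ := by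
  have h := log_partitionFn_sub_le_log_partitionFn_add hH₁ (hH₂.sub hH₁) β
  rw [add_sub_cancel] at h
  have hs := (le_abs_self _).trans (abs_re_gibbsState_le hH₁ β (H₂ - H₁))
  nlinarith

/-- `|log Z(H₁) - log Z(H₂)| ≤ β ‖H₁ - H₂‖`. [folklore] -/
theorem abs_log_partitionFn_sub_log_partitionFn_le {H₁ H₂ : Matrix n n ℂ} (hH₁ : H₁.IsHermitian)
    (hH₂ : H₂.IsHermitian) [Nonempty n] {β : ℝ} (hβ : 0 ≤ β) :
    |Real.log (partitionFn β H₁).re - Real.log (partitionFn β H₂).re| ≤ β * ‖H₁ - H₂‖ := by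
  rw [abs_le]
  constructor
  · have h := log_partitionFn_sub_log_partitionFn_le hH₂ hH₁ hβ
    linarith
  · have h := log_partitionFn_sub_log_partitionFn_le hH₁ hH₂ hβ
    rwa [norm_sub_rev] at h

/-- **Monotonicity of the free energy**: `H₁ ≤ H₂` (i.e. `H₂ - H₁ ≥ 0`) implies
`log Z(H₂) ≤ log Z(H₁)` (`β ≥ 0`). [folklore] -/
theorem log_partitionFn_le_of_posSemidef {H₁ H₂ : Matrix n n ℂ} (hH₁ : H₁.IsHermitian)
    (hH₂ : H₂.IsHermitian) [Nonempty n] {β : ℝ} (hβ : 0 ≤ β) (h : (H₂ - H₁).PosSemidef) :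
    Real.log (partitionFn β H₂).re ≤ Real.log (partitionFn β H₁).re := by
  have h1 := log_partitionFn_sub_le_log_partitionFn_add hH₂ (hH₁.sub hH₂) β
  rw [add_sub_cancel] at h1
  have hnn : 0 ≤ (gibbsState β H₂ (H₂ - H₁)).re :=
    (Complex.nonneg_iff.mp (gibbsState_nonneg_of_posSemidef β hH₂ h)).1
  have hneg : (gibbsState β H₂ (H₁ - H₂)).re = -(gibbsState β H₂ (H₂ - H₁)).re := by
    rw [← neg_sub, map_neg, Complex.neg_re]
  rw [hneg] at h1
  nlinarith

/-- Scalar shifts of the Hamiltonian: `Z(H + r) = e^{-βr} Z(H)`. [folklore] -/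
theorem partitionFn_add_smul_one (β : ℝ) (H : Matrix n n ℂ) (r : ℝ) :
    partitionFn β (H + (r : ℂ) • 1) = (Real.exp (-(β * r)) : ℂ) * partitionFn β H := by
  have h := partitionFn_sub_smul_add_smul_one β H 0 0 r
  simp only [smul_zero, sub_zero, add_zero] at h
  exact h

/-- `log Z(H + r) = log Z(H) - β r`. [folklore] -/
theorem log_partitionFn_add_smul_one (hH : H.IsHermitian) [Nonempty n] (β r : ℝ) :
    Real.log (partitionFn β (H + (r : ℂ) • 1)).re = Real.log (partitionFn β H).re - β * r := by
  rw [partitionFn_add_smul_one, Complex.re_ofReal_mul,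
    Real.log_mul (Real.exp_pos _).ne' (partitionFn_re_pos hH β).ne', Real.log_exp]
  ring

/-- `e^{-sH} e^{-tH} = e^{-(s+t)H}`. [folklore] -/
theorem gibbsWeight_mul_gibbsWeight (s t : ℝ) (H : Matrix n n ℂ) :
    gibbsWeight s H * gibbsWeight t H = gibbsWeight (s + t) H := by
  rw [gibbsWeight, gibbsWeight, gibbsWeight, ← Matrix.exp_add_of_commute]
  · congr 1
    push_cast
    module
  · exact ((Commute.refl H).smul_left _).smul_right _

/-- The Duhamel integrand `s ↦ tr(A e^{-sβH} B e^{-(1-s)βH})` is continuous. [folklore] -/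
theorem continuous_trace_duhamel_integrand (β : ℝ) (H A B : Matrix n n ℂ) :
    Continuous fun s : ℝ =>
      (A * gibbsWeight (s * β) H * B * gibbsWeight ((1 - s) * β) H).trace := by
  have h2 : Continuous fun s : ℝ =>
      A * (exp (s • (-(β : ℂ) • H)) * B * exp ((1 - s) • (-(β : ℂ) • H))) :=
    continuous_const.mul (continuous_exp_smul_mul_mul_exp (-(β : ℂ) • H) B (-(β : ℂ) • H))
  refine h2.matrix_trace.congr fun s => ?_
  rw [exp_smul_neg_smul_eq_gibbsWeight, exp_smul_neg_smul_eq_gibbsWeight]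
  simp only [Matrix.mul_assoc]

/-- **The Duhamel function of a centred observable**:
`(A - c, A - c) = (A, A) - 2c⟨A⟩ + c²` (bilinearity, `(1, A) = (A, 1) = ⟨A⟩`, `(1, 1) = 1`).
[folklore] -/
theorem duhamel_sub_smul_one (hH : H.IsHermitian) [Nonempty n] (β : ℝ) (A : Matrix n n ℂ)
    (c : ℂ) :
    duhamel β H (A - c • 1) (A - c • 1) =
      duhamel β H A A - 2 * c * gibbsState β H A + c ^ 2 := by
  have hZ : partitionFn β H ≠ 0 := by
    rw [partitionFn_eq_re hH β, Ne, Complex.ofReal_eq_zero]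
    exact (partitionFn_re_pos hH β).ne'
  have hpt : ∀ s : ℝ, ((A - c • 1) * gibbsWeight (s * β) H * (A - c • 1) *
      gibbsWeight ((1 - s) * β) H).trace =
      (A * gibbsWeight (s * β) H * A * gibbsWeight ((1 - s) * β) H).trace -
        (2 * c * (A * gibbsWeight β H).trace - c ^ 2 * partitionFn β H) := by
    intro s
    have hg : gibbsWeight (s * β) H * gibbsWeight ((1 - s) * β) H = gibbsWeight β H := by
      rw [gibbsWeight_mul_gibbsWeight]; congr 1; ring
    have hg' : gibbsWeight ((1 - s) * β) H * gibbsWeight (s * β) H = gibbsWeight β H := by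
      rw [gibbsWeight_mul_gibbsWeight]; congr 1; ring
    have expand : (A - c • (1 : Matrix n n ℂ)) * gibbsWeight (s * β) H * (A - c • 1) *
        gibbsWeight ((1 - s) * β) H =
        A * gibbsWeight (s * β) H * A * gibbsWeight ((1 - s) * β) H
          - c • (A * (gibbsWeight (s * β) H * gibbsWeight ((1 - s) * β) H))
          - c • (gibbsWeight (s * β) H * A * gibbsWeight ((1 - s) * β) H)
          + (c * c) • (gibbsWeight (s * β) H * gibbsWeight ((1 - s) * β) H) := by
      simp only [Matrix.sub_mul, Matrix.mul_sub, Matrix.smul_mul, Matrix.mul_smul,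
        Matrix.one_mul, Matrix.mul_one, Matrix.mul_assoc]
      module
    have e2 : (gibbsWeight (s * β) H * A * gibbsWeight ((1 - s) * β) H).trace =
        (A * gibbsWeight β H).trace := by
      rw [Matrix.mul_assoc, trace_mul_comm, Matrix.mul_assoc, hg']
    rw [expand, trace_add, trace_sub, trace_sub, trace_smul, trace_smul, trace_smul, hg, e2]
    simp only [smul_eq_mul]
    rw [show (gibbsWeight β H).trace = partitionFn β H from rfl]
    ring
  have hint : IntervalIntegrable (fun s : ℝ =>
      (A * gibbsWeight (s * β) H * A * gibbsWeight ((1 - s) * β) H).trace) volume 0 1 :=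
    (continuous_trace_duhamel_integrand β H A A).intervalIntegrable 0 1
  rw [duhamel, duhamel, gibbsState_apply, trace_mul_comm (gibbsWeight β H) A]
  simp_rw [hpt]
  rw [intervalIntegral.integral_sub hint intervalIntegrable_const,
    intervalIntegral.integral_const]
  simp only [sub_zero, one_smul]
  generalize (∫ s in (0 : ℝ)..1,
    (A * gibbsWeight (s * β) H * A * gibbsWeight ((1 - s) * β) H).trace) = X
  field_simp
  ring

end Toolkit

/-! ### Sources: the magnetisation `s ↦ Re⟨A⟩_{H - sA}` and its derivative -/

section Source

variable {H A : Matrix n n ℂ}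

omit [Fintype n] [DecidableEq n] in
/-- The source Hamiltonian in exponential coordinates: `-β (H - s A) = -βH + s (βA)`. [folklore] -/
theorem neg_smul_sub_smul (β : ℝ) (H A : Matrix n n ℂ) (s : ℝ) :
    -(β : ℂ) • (H - (s : ℂ) • A) = -(β : ℂ) • H + s • ((β : ℂ) • A) := by
  rw [← Complex.coe_smul]
  module

/-- `e^{-β(H - sA)} = exp(-βH + s βA)`. [folklore] -/
theorem gibbsWeight_sub_smul (β : ℝ) (H A : Matrix n n ℂ) (s : ℝ) :
    gibbsWeight β (H - (s : ℂ) • A) = exp (-(β : ℂ) • H + s • ((β : ℂ) • A)) := by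
  rw [gibbsWeight, neg_smul_sub_smul]

omit [Fintype n] [DecidableEq n] in
/-- `H - sA` is Hermitian for Hermitian `H`, `A` and real `s`. [folklore] -/
theorem isHermitian_sub_smul (hH : H.IsHermitian) (hA : A.IsHermitian) (s : ℝ) :
    (H - (s : ℂ) • A).IsHermitian :=
  hH.sub (isHermitian_real_smul hA s)

/-- **The susceptibility formula**: for Hermitian `H`, `A` the source magnetisation
`m(s) = Re ⟨A⟩_{H - sA}` is differentiable, with
`m'(s) = β ((A, A)_{H - sA} - m(s)²)` — `β` times the Duhamel variance of `A`
(Duhamel's formula for `d/ds e^{-β(H - sA)}`, `Matrix.hasDerivAt_re_trace_mul_exp_add_smul`).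
[folklore] -/
theorem hasDerivAt_re_gibbsState_source (hH : H.IsHermitian) (hA : A.IsHermitian) [Nonempty n]
    {β : ℝ} (hβ : 0 < β) (s : ℝ) :
    HasDerivAt (fun t : ℝ => (gibbsState β (H - (t : ℂ) • A) A).re)
      (β * ((duhamel β (H - (s : ℂ) • A) A A).re -
        (gibbsState β (H - (s : ℂ) • A) A).re ^ 2)) s := by
  have hβ0 : β ≠ 0 := hβ.ne'
  -- exponential coordinates
  set 𝔄 : Matrix n n ℂ := -(β : ℂ) • H with h𝔄
  set Y : Matrix n n ℂ := (β : ℂ) • A with hY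
  set Z : ℝ → ℝ := fun t => (exp (𝔄 + t • Y)).trace.re with hZdef
  set N : ℝ → ℝ := fun t => (Y * exp (𝔄 + t • Y)).trace.re with hNdef
  have hHt : ∀ t : ℝ, (H - (t : ℂ) • A).IsHermitian := fun t => isHermitian_sub_smul hH hA t
  have hgW : ∀ t : ℝ, gibbsWeight β (H - (t : ℂ) • A) = exp (𝔄 + t • Y) := fun t =>
    gibbsWeight_sub_smul β H A t
  have hZt : ∀ t : ℝ, Z t = (partitionFn β (H - (t : ℂ) • A)).re := by
    intro t
    simp only [hZdef, partitionFn, hgW]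
  have hZpos : ∀ t, 0 < Z t := fun t => by rw [hZt]; exact partitionFn_re_pos (hHt t) β
  -- `m t = N t / (β Z t)`
  have hm : ∀ t : ℝ, (gibbsState β (H - (t : ℂ) • A) A).re = β⁻¹ * (N t / Z t) := by
    intro t
    have hZne : Z t ≠ 0 := (hZpos t).ne'
    have hZc : partitionFn β (H - (t : ℂ) • A) = ((Z t : ℝ) : ℂ) := by
      rw [hZt]; exact partitionFn_eq_re (hHt t) β
    have hN : N t = β * (A * exp (𝔄 + t • Y)).trace.re := by
      simp only [hNdef, hY, Matrix.smul_mul, trace_smul, smul_eq_mul, Complex.re_ofReal_mul]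
    rw [gibbsState_apply, hZc, ← Complex.ofReal_inv, Complex.re_ofReal_mul, trace_mul_comm, hgW,
      hN]
    field_simp
  -- derivatives of `Z` and `N`
  have hZ' : HasDerivAt Z (N s) s := hasDerivAt_re_trace_exp_add_smul 𝔄 Y s
  have hN' : HasDerivAt N (β ^ 2 * (Z s * (duhamel β (H - (s : ℂ) • A) A A).re)) s := by
    have h := hasDerivAt_re_trace_mul_exp_add_smul 𝔄 Y s
    refine h.congr_deriv ?_
    have hexp : 𝔄 + s • Y = -(β : ℂ) • (H - (s : ℂ) • A) := (neg_smul_sub_smul β H A s).symm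
    have key : ∀ u : ℝ, (Y * (exp (u • (𝔄 + s • Y)) * Y * exp ((1 - u) • (𝔄 + s • Y)))).trace =
        (β : ℂ) ^ 2 * (A * gibbsWeight (u * β) (H - (s : ℂ) • A) * A *
          gibbsWeight ((1 - u) * β) (H - (s : ℂ) • A)).trace := by
      intro u
      rw [hexp, exp_smul_neg_smul_eq_gibbsWeight, exp_smul_neg_smul_eq_gibbsWeight, hY]
      simp only [Matrix.smul_mul, Matrix.mul_smul, trace_smul, smul_eq_mul, Matrix.mul_assoc]
      ring
    simp_rw [key]
    rw [intervalIntegral.integral_const_mul,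
      show (β : ℂ) ^ 2 = ((β ^ 2 : ℝ) : ℂ) by push_cast; ring, Complex.re_ofReal_mul,
      (hHt s).re_duhamel β A A]
    have hZsum : Z s = ∑ i, Real.exp (-(β * (hHt s).eigenvalues i)) := by
      rw [hZt, (hHt s).partitionFn_eq_ofReal, Complex.ofReal_re]
    rw [hZsum, ← mul_assoc (∑ i, Real.exp (-(β * (hHt s).eigenvalues i))),
      mul_inv_cancel₀ ((hHt s).sum_exp_pos β).ne', one_mul]
  -- quotient rule
  have hq : HasDerivAt (fun t => N t / Z t)
      ((β ^ 2 * (Z s * (duhamel β (H - (s : ℂ) • A) A A).re) * Z s - N s * N s) / Z s ^ 2) s :=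
    hN'.div hZ' (hZpos s).ne'
  have hfun : (fun t : ℝ => (gibbsState β (H - (t : ℂ) • A) A).re) =
      fun t => β⁻¹ * (N t / Z t) :=
    funext hm
  rw [hfun]
  refine (hq.const_mul β⁻¹).congr_deriv ?_
  have hZne : Z s ≠ 0 := (hZpos s).ne'
  rw [hm s]
  field_simp

/-- **A good source** (replaces Bogoliubov Jr.'s averaging over sources): on any window
`(-r, r)` there is a source strength `s` at which the Duhamel variance of `A` in the Gibbs state
of `H - sA` is at most `‖A‖/(βr)` — the mean value theorem for the magnetisation
`s ↦ Re⟨A⟩_{H - sA}`, which is bounded by `‖A‖`. [folklore] -/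
theorem exists_source_duhamel_var_le (hH : H.IsHermitian) (hA : A.IsHermitian) [Nonempty n]
    {β r : ℝ} (hβ : 0 < β) (hr : 0 < r) :
    ∃ s ∈ Set.Ioo (-r) r, (duhamel β (H - (s : ℂ) • A) A A).re -
      (gibbsState β (H - (s : ℂ) • A) A).re ^ 2 ≤ ‖A‖ / (β * r) := by
  set m : ℝ → ℝ := fun t => (gibbsState β (H - (t : ℂ) • A) A).re with hmdef
  set m' : ℝ → ℝ := fun t => β * ((duhamel β (H - (t : ℂ) • A) A A).re -
    (gibbsState β (H - (t : ℂ) • A) A).re ^ 2) with hm'def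
  have hd : ∀ t, HasDerivAt m (m' t) t := fun t => hasDerivAt_re_gibbsState_source hH hA hβ t
  obtain ⟨s, hs, hslope⟩ := exists_hasDerivAt_eq_slope m m' (by linarith : -r < r)
    (fun t _ => (hd t).continuousAt.continuousWithinAt) (fun t _ => hd t)
  refine ⟨s, hs, ?_⟩
  have h1 : |m r| ≤ ‖A‖ := abs_re_gibbsState_le (isHermitian_sub_smul hH hA r) β A
  have h2 : |m (-r)| ≤ ‖A‖ := abs_re_gibbsState_le (isHermitian_sub_smul hH hA (-r)) β A
  have h3 : m r - m (-r) ≤ 2 * ‖A‖ := by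
    linarith [le_abs_self (m r), neg_abs_le (m (-r))]
  have h4 : m' s * (2 * r) = m r - m (-r) := by
    rw [hslope]
    field_simp
    ring
  have h5 : m' s = β * ((duhamel β (H - (s : ℂ) • A) A A).re -
    (gibbsState β (H - (s : ℂ) • A) A).re ^ 2) := rfl
  rw [le_div_iff₀ (mul_pos hβ hr)]
  have h6 : ((duhamel β (H - (s : ℂ) • A) A A).re -
      (gibbsState β (H - (s : ℂ) • A) A).re ^ 2) * (β * r) = (m' s * (2 * r)) / 2 := by
    rw [h5]; ring
  rw [h6, h4]
  linarith

end Source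

/-! ### One attractive Hermitian channel: Bogoliubov Jr.'s estimate -/

section OneChannel

variable {K A : Matrix n n ℂ}

omit [DecidableEq n] in
/-- `A²` is Hermitian for Hermitian `A`. [folklore] -/
theorem isHermitian_mul_self' (hA : A.IsHermitian) : (A * A).IsHermitian := by
  rw [IsHermitian, conjTranspose_mul, hA.eq]

/-- Completing the square: `K - vA² - sA + v(A - m)² = K - (2mv)A - sA + m²v`. [folklore] -/
theorem source_add_square (K A : Matrix n n ℂ) (v sc m : ℂ) :
    K - v • (A * A) - sc • A + v • ((A - m • 1) * (A - m • 1)) =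
      K - (2 * m * v) • A - sc • A + (m ^ 2 * v) • (1 : Matrix n n ℂ) := by
  simp only [Matrix.sub_mul, Matrix.mul_sub, Matrix.smul_mul, Matrix.mul_smul, Matrix.one_mul,
    Matrix.mul_one, smul_sub]
  module

/-- The double commutator of the centred channel with the sourced model Hamiltonian only sees
the kinetic part: `[A - m, [K - vA² - sA, A - m]] = -[A, [A, K]]`. [folklore] -/
theorem doubleComm_source (K A : Matrix n n ℂ) (v sc m : ℂ) :
    (A - m • 1) * ((K - v • (A * A) - sc • A) * (A - m • 1) -
        (A - m • 1) * (K - v • (A * A) - sc • A)) -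
      ((K - v • (A * A) - sc • A) * (A - m • 1) -
        (A - m • 1) * (K - v • (A * A) - sc • A)) * (A - m • 1) = -⁅A, ⁅A, K⁆⁆ := by
  simp only [Ring.lie_def, Matrix.sub_mul, Matrix.mul_sub, Matrix.smul_mul, Matrix.mul_smul,
    Matrix.one_mul, Matrix.mul_one, smul_sub, Matrix.mul_assoc]
  module

/-- **Bogoliubov Jr.'s estimate for one attractive Hermitian channel** (the approximating
Hamiltonian method, quantitative finite-volume form). Let `K`, `A` be Hermitian, `β, V, r > 0`,
`‖A‖ ≤ C V` and `‖[A, [A, K]]‖ ≤ κ V`. Then there is a real `x`, `|x| ≤ C`, with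
`log Z(K - V⁻¹A²) ≤ log Z(K - 2xA) - βVx² + 2βrCV + C/r + (β/2)√(Cκ/r)`,
i.e. in pressure units `p[K - V⁻¹A²] ≤ p[K - 2xA] - x² + 2rC + (C/(βr) + ½√(Cκ/r))/V`.
Proof (Bogoliubov Jr. 1966/1972; BBZKT 1984, §1): switch on a source `-sA` with
`|s| < r` chosen by `exists_source_duhamel_var_le` (cost `βr‖A‖` twice), apply the Bogoliubov
convexity inequality at `Γ = K - V⁻¹A² - sA` with the completed square
`Γ + V⁻¹(A - ⟨A⟩_Γ)² = K - 2xA - sA + x²V`, `x = ⟨A⟩_Γ/V`, and bound the fluctuation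
`V⁻¹⟨(A - ⟨A⟩)²⟩_Γ` by the Falk–Bruch / Bogoliubov Jr. inequality (`Matrix.falkBruch_sum_le`)
through the Duhamel variance `≤ ‖A‖/(βr)` and the double commutator `[A,[A,K]]`.
[cite: BruPedra2013, Appendix: The approximating Hamiltonian method, Theorem 107]
[cite: BogolyubovJrEtAl1984, approximating Hamiltonian method (attraction; via BruPedra2013)] -/
theorem log_partitionFn_oneChannel_le (hK : K.IsHermitian) (hA : A.IsHermitian) [Nonempty n]
    {β V r C κ : ℝ} (hβ : 0 < β) (hV : 0 < V) (hr : 0 < r) (hC : ‖A‖ ≤ C * V)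
    (hκ : ‖⁅A, ⁅A, K⁆⁆‖ ≤ κ * V) :
    ∃ x : ℝ, |x| ≤ C ∧
      Real.log (partitionFn β (K - ((V⁻¹ : ℝ) : ℂ) • (A * A))).re ≤
        Real.log (partitionFn β (K - ((2 * x : ℝ) : ℂ) • A)).re - β * V * x ^ 2 +
          (2 * β * r * C * V + C / r + β / 2 * Real.sqrt (C * κ / r)) := by
  have hβ0 : β ≠ 0 := hβ.ne'
  have hV0 : V ≠ 0 := hV.ne'
  have hC0 : 0 ≤ C := by
    by_contra h
    push Not at h
    have := (norm_nonneg A).trans hC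
    nlinarith
  have hκ0 : 0 ≤ κ := by
    by_contra h
    push Not at h
    have := (norm_nonneg ⁅A, ⁅A, K⁆⁆).trans hκ
    nlinarith
  -- the model `Hm = K - V⁻¹ A²`, a good source `s`, the sourced Hamiltonian `Γ`
  set Hm : Matrix n n ℂ := K - ((V⁻¹ : ℝ) : ℂ) • (A * A) with hHm
  have hHmh : Hm.IsHermitian := hK.sub (isHermitian_real_smul (isHermitian_mul_self' hA) V⁻¹)
  obtain ⟨s, hs, hvar⟩ := exists_source_duhamel_var_le hHmh hA hβ hr
  have hsr : |s| ≤ r := (abs_lt.mpr hs).le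
  set Γ : Matrix n n ℂ := Hm - (s : ℂ) • A with hΓ
  have hΓh : Γ.IsHermitian := isHermitian_sub_smul hHmh hA s
  set m₀ : ℝ := (gibbsState β Γ A).re with hm₀
  have hm₀C : |m₀| ≤ C * V := (abs_re_gibbsState_le hΓh β A).trans hC
  set x : ℝ := m₀ / V with hx
  refine ⟨x, ?_, ?_⟩
  · rw [hx, abs_div, abs_of_pos hV, div_le_iff₀ hV]
    exact hm₀C
  -- Hermitian bookkeeping for the approximating side
  have hKx : (K - ((2 * x : ℝ) : ℂ) • A).IsHermitian := isHermitian_sub_smul hK hA _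
  have hKxs : (K - ((2 * x : ℝ) : ℂ) • A - (s : ℂ) • A).IsHermitian :=
    isHermitian_sub_smul hKx hA s
  -- (1) source on
  have h1 : Real.log (partitionFn β Hm).re ≤
      Real.log (partitionFn β Γ).re + β * r * (C * V) := by
    have h := log_partitionFn_sub_log_partitionFn_le hHmh hΓh hβ.le
    have hn : ‖Γ - Hm‖ ≤ r * (C * V) := by
      rw [hΓ, sub_sub_cancel_left, norm_neg, norm_smul, Complex.norm_real, Real.norm_eq_abs]
      exact mul_le_mul hsr hC (norm_nonneg _) hr.le
    have := mul_le_mul_of_nonneg_left hn hβ.le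
    linarith
  -- (2) the Bogoliubov convexity inequality at `Γ` with the completed square
  set B : Matrix n n ℂ := A - (m₀ : ℂ) • 1 with hB
  have hBh : B.IsHermitian := hA.sub (isHermitian_real_smul isHermitian_one m₀)
  set W : Matrix n n ℂ := ((V⁻¹ : ℝ) : ℂ) • (B * B) with hW
  have hWh : W.IsHermitian := isHermitian_real_smul (isHermitian_mul_self' hBh) V⁻¹
  have h2 : Real.log (partitionFn β Γ).re ≤
      Real.log (partitionFn β (Γ + W)).re + β * V⁻¹ * (gibbsState β Γ (B * B)).re := by
    have h := log_partitionFn_sub_le_log_partitionFn_add hΓh hWh β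
    have e : (gibbsState β Γ W).re = V⁻¹ * (gibbsState β Γ (B * B)).re := by
      rw [hW, map_smul, smul_eq_mul, Complex.re_ofReal_mul]
    rw [e] at h
    linarith
  -- (3) the completed square is the sourced approximating Hamiltonian, shifted by `x² V`
  have h3 : Γ + W = (K - ((2 * x : ℝ) : ℂ) • A - (s : ℂ) • A) + ((x ^ 2 * V : ℝ) : ℂ) • 1 := by
    have e1 : ((2 * x : ℝ) : ℂ) = 2 * (m₀ : ℂ) * ((V⁻¹ : ℝ) : ℂ) := by
      rw [hx]; push_cast; ring
    have e2 : ((x ^ 2 * V : ℝ) : ℂ) = (m₀ : ℂ) ^ 2 * ((V⁻¹ : ℝ) : ℂ) := by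
      have hV0' : (V : ℂ) ≠ 0 := by exact_mod_cast hV0
      rw [hx]; push_cast; field_simp
    rw [e1, e2, hW, hB, hΓ, hHm]
    exact source_add_square K A _ _ _
  have h3' : Real.log (partitionFn β (Γ + W)).re =
      Real.log (partitionFn β (K - ((2 * x : ℝ) : ℂ) • A - (s : ℂ) • A)).re - β * (x ^ 2 * V) := by
    rw [h3, log_partitionFn_add_smul_one hKxs]
  -- (4) source off
  have h4 : Real.log (partitionFn β (K - ((2 * x : ℝ) : ℂ) • A - (s : ℂ) • A)).re ≤
      Real.log (partitionFn β (K - ((2 * x : ℝ) : ℂ) • A)).re + β * r * (C * V) := by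
    have h := log_partitionFn_sub_log_partitionFn_le hKxs hKx hβ.le
    have hn : ‖(K - ((2 * x : ℝ) : ℂ) • A) - (K - ((2 * x : ℝ) : ℂ) • A - (s : ℂ) • A)‖ ≤
        r * (C * V) := by
      rw [sub_sub_cancel, norm_smul, Complex.norm_real, Real.norm_eq_abs]
      exact mul_le_mul hsr hC (norm_nonneg _) hr.le
    have := mul_le_mul_of_nonneg_left hn hβ.le
    linarith
  -- (5) the fluctuation bound (Falk–Bruch / Bogoliubov Jr.)
  have h5 : β * V⁻¹ * (gibbsState β Γ (B * B)).re ≤ C / r + β / 2 * Real.sqrt (C * κ / r) := by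
    -- Duhamel variance at the good source
    have hBBd : (duhamel β Γ B B).re ≤ C * V / (β * r) := by
      have e := duhamel_sub_smul_one hΓh β A (m₀ : ℂ)
      have e' : (duhamel β Γ B B).re = (duhamel β Γ A A).re - m₀ ^ 2 := by
        rw [hB, e, show (2 : ℂ) * (m₀ : ℂ) = ((2 * m₀ : ℝ) : ℂ) by push_cast; ring,
          Complex.add_re, Complex.sub_re, Complex.re_ofReal_mul, ← Complex.ofReal_pow,
          Complex.ofReal_re, ← hm₀]
        ring
      rw [e']
      exact hvar.trans (div_le_div_of_nonneg_right hC (by positivity))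
    -- the double commutator
    have hdc : B * (Γ * B - B * Γ) - (Γ * B - B * Γ) * B = -⁅A, ⁅A, K⁆⁆ := by
      rw [hB, hΓ, hHm]
      exact doubleComm_source K A _ _ _
    have hc : (gibbsState β Γ (B * (Γ * B - B * Γ) - (Γ * B - B * Γ) * B)).re ≤ κ * V := by
      refine (le_abs_self _).trans ((abs_re_gibbsState_le hΓh β _).trans ?_)
      rw [hdc, norm_neg]
      exact hκ
    have hc0 : 0 ≤ (gibbsState β Γ (B * (Γ * B - B * Γ) - (Γ * B - B * Γ) * B)).re :=
      hΓh.re_gibbsState_doubleComm_nonneg hBh hβ.le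
    -- Falk–Bruch for the single observable `B`
    have hFB := falkBruch_sum_le_of_le hΓh hβ.le (ι := Unit) (A := fun _ => B) (fun _ => hBh)
      (b₀ := C * V / (β * r)) (by rw [Fintype.sum_unique]; exact hBBd)
    rw [Fintype.sum_unique, Fintype.sum_unique] at hFB
    have hb0 : 0 ≤ β * (C * V / (β * r)) := by positivity
    have hFB' : (gibbsState β Γ (B * B)).re ≤
        C * V / (β * r) + 1 / 2 * Real.sqrt (β * (C * V / (β * r)) * (κ * V)) :=
      hFB.trans (by gcongr)
    have hsq : Real.sqrt (β * (C * V / (β * r)) * (κ * V)) = V * Real.sqrt (C * κ / r) := by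
      rw [show β * (C * V / (β * r)) * (κ * V) = V ^ 2 * (C * κ / r) by field_simp,
        Real.sqrt_mul (sq_nonneg V), Real.sqrt_sq hV.le]
    rw [hsq] at hFB'
    have := mul_le_mul_of_nonneg_left hFB' (by positivity : 0 ≤ β * V⁻¹)
    refine this.trans (le_of_eq ?_)
    field_simp
  -- (6) assemble
  have hx2 : β * (x ^ 2 * V) = β * V * x ^ 2 := by ring
  linarith [h1, h2, h3', h4, h5, hx2]

end OneChannel

/-! ### Two Hermitian channels (one complex separable channel) -/

section TwoChannel

variable {T A₁ A₂ : Matrix n n ℂ}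

omit [DecidableEq n] in
/-- `ad_B² (A²) = (ad_B² A) A + 2 (ad_B A)² + A (ad_B² A)` (`ad_B` is a derivation). [folklore] -/
theorem lie_lie_mul_self (B A : Matrix n n ℂ) :
    ⁅B, ⁅B, A * A⁆⁆ = ⁅B, ⁅B, A⁆⁆ * A + (2 : ℂ) • (⁅B, A⁆ * ⁅B, A⁆) + A * ⁅B, ⁅B, A⁆⁆ := by
  simp only [Ring.lie_def, two_smul]
  noncomm_ring

/-- `‖[B,[B,A²]]‖ ≤ 2‖[B,[B,A]]‖ ‖A‖ + 2‖[B,A]‖²`. [folklore] -/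
theorem norm_lie_lie_mul_self_le (B A : Matrix n n ℂ) :
    ‖⁅B, ⁅B, A * A⁆⁆‖ ≤ 2 * (‖⁅B, ⁅B, A⁆⁆‖ * ‖A‖) + 2 * ‖⁅B, A⁆‖ ^ 2 := by
  rw [lie_lie_mul_self]
  have e1 : ‖⁅B, ⁅B, A⁆⁆ * A‖ ≤ ‖⁅B, ⁅B, A⁆⁆‖ * ‖A‖ := norm_mul_le _ _
  have e2 : ‖(2 : ℂ) • (⁅B, A⁆ * ⁅B, A⁆)‖ ≤ 2 * ‖⁅B, A⁆‖ ^ 2 := by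
    rw [norm_smul, Complex.norm_two, sq]
    exact mul_le_mul_of_nonneg_left (norm_mul_le _ _) two_pos.le
  have e3 : ‖A * ⁅B, ⁅B, A⁆⁆‖ ≤ ‖A‖ * ‖⁅B, ⁅B, A⁆⁆‖ := norm_mul_le _ _
  have h := norm_add₃_le (a := ⁅B, ⁅B, A⁆⁆ * A) (b := (2 : ℂ) • (⁅B, A⁆ * ⁅B, A⁆))
    (c := A * ⁅B, ⁅B, A⁆⁆)
  nlinarith [h, e1, e2, e3, mul_comm ‖A‖ ‖⁅B, ⁅B, A⁆⁆‖]

omit [Fintype n] [DecidableEq n] in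
/-- `[X, Y]ᴴ = -[Xᴴ, Yᴴ]`. [folklore] -/
theorem conjTranspose_lie (X Y : Matrix n n ℂ) [Fintype n] : (⁅X, Y⁆)ᴴ = -⁅Xᴴ, Yᴴ⁆ := by
  simp only [Ring.lie_def, conjTranspose_sub, conjTranspose_mul]
  exact (neg_sub _ _).symm

omit [DecidableEq n] in
/-- `i[A₁, A₂]` is Hermitian for Hermitian `A₁`, `A₂`. [folklore] -/
theorem isHermitian_I_smul_lie (hA₁ : A₁.IsHermitian) (hA₂ : A₂.IsHermitian) :
    (Complex.I • ⁅A₁, A₂⁆).IsHermitian := by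
  rw [IsHermitian, conjTranspose_smul, conjTranspose_lie, hA₁.eq, hA₂.eq, Complex.star_def,
    Complex.conj_I, smul_neg, neg_smul, neg_neg]

/-- **Bogoliubov Jr.'s estimate for one complex separable channel `U = A₁ + iA₂`**, i.e. two
Hermitian channels `A₁`, `A₂` with `U⋆U = A₁² + A₂² + i[A₁, A₂]`, treated successively by
`log_partitionFn_oneChannel_le` (first `A₂` with kinetic part `T - V⁻¹A₁²`, then `A₁` with
kinetic part `T - 2yA₂`), after discarding the commutator `V⁻¹ i[A₁,A₂]` (norm `≤ C₂`) by the
Lipschitz bound. Hypotheses: `‖A_j‖ ≤ CV`, `‖[A₁,A₂]‖ ≤ C₂V`, `‖[A_j,[A_j,T]]‖ ≤ κ_T V`,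
`‖[A_j,[A_j,A_k]]‖ ≤ κ_A V`. Conclusion: for some real `x, y`,
`log Z(T - V⁻¹(A₁² + A₂² + i[A₁,A₂])) ≤ log Z(T - 2xA₁ - 2yA₂) - βV(x² + y²) + βC₂ + 4βrCV`
`+ 2C/r + (β/2)(√(Cκ₁/r) + √(Cκ₂/r))`, `κ₁ = κ_T + 2κ_A C + 2C₂²`, `κ₂ = κ_T + 2Cκ_A`.
[cite: BruPedra2013, Appendix: The approximating Hamiltonian method, Theorem 107]
[cite: BogolyubovJrEtAl1984, approximating Hamiltonian method (attraction; via BruPedra2013)] -/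
theorem log_partitionFn_twoChannel_le (hT : T.IsHermitian) (hA₁ : A₁.IsHermitian)
    (hA₂ : A₂.IsHermitian) [Nonempty n] {β V r C C₂ κT κA : ℝ} (hβ : 0 < β) (hV : 0 < V)
    (hr : 0 < r) (hn1 : ‖A₁‖ ≤ C * V) (hn2 : ‖A₂‖ ≤ C * V) (h12 : ‖⁅A₁, A₂⁆‖ ≤ C₂ * V)
    (hT1 : ‖⁅A₁, ⁅A₁, T⁆⁆‖ ≤ κT * V) (hT2 : ‖⁅A₂, ⁅A₂, T⁆⁆‖ ≤ κT * V)
    (hA12 : ‖⁅A₁, ⁅A₁, A₂⁆⁆‖ ≤ κA * V) (hA21 : ‖⁅A₂, ⁅A₂, A₁⁆⁆‖ ≤ κA * V) :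
    ∃ x y : ℝ,
      Real.log (partitionFn β
          (T - ((V⁻¹ : ℝ) : ℂ) • (A₁ * A₁ + A₂ * A₂ + Complex.I • ⁅A₁, A₂⁆))).re ≤
        Real.log (partitionFn β (T - ((2 * x : ℝ) : ℂ) • A₁ - ((2 * y : ℝ) : ℂ) • A₂)).re -
            β * V * (x ^ 2 + y ^ 2) +
          (β * C₂ + 4 * β * r * C * V + 2 * C / r +
            β / 2 * (Real.sqrt (C * (κT + 2 * κA * C + 2 * C₂ ^ 2) / r) +
              Real.sqrt (C * (κT + 2 * C * κA) / r))) := by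
  have hV0 : V ≠ 0 := hV.ne'
  have hC0 : 0 ≤ C := by
    by_contra h
    push Not at h
    have := (norm_nonneg A₁).trans hn1
    nlinarith
  have hκA0 : 0 ≤ κA := by
    by_contra h
    push Not at h
    have := (norm_nonneg ⁅A₁, ⁅A₁, A₂⁆⁆).trans hA12
    nlinarith
  have hvn : ‖((V⁻¹ : ℝ) : ℂ)‖ = V⁻¹ := by
    rw [Complex.norm_real, Real.norm_of_nonneg (inv_nonneg.2 hV.le)]
  -- the kinetic part of step 1
  set K₁ : Matrix n n ℂ := T - ((V⁻¹ : ℝ) : ℂ) • (A₁ * A₁) with hK₁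
  have hK₁h : K₁.IsHermitian := hT.sub (isHermitian_real_smul (isHermitian_mul_self' hA₁) V⁻¹)
  -- step 0: discard `V⁻¹ i[A₁, A₂]`
  have h0 : Real.log (partitionFn β
      (T - ((V⁻¹ : ℝ) : ℂ) • (A₁ * A₁ + A₂ * A₂ + Complex.I • ⁅A₁, A₂⁆))).re ≤
      Real.log (partitionFn β (K₁ - ((V⁻¹ : ℝ) : ℂ) • (A₂ * A₂))).re + β * C₂ := by
    have hHmh : (T - ((V⁻¹ : ℝ) : ℂ) • (A₁ * A₁ + A₂ * A₂ + Complex.I • ⁅A₁, A₂⁆)).IsHermitian :=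
      hT.sub (isHermitian_real_smul (((isHermitian_mul_self' hA₁).add
        (isHermitian_mul_self' hA₂)).add (isHermitian_I_smul_lie hA₁ hA₂)) V⁻¹)
    have hH₂h : (K₁ - ((V⁻¹ : ℝ) : ℂ) • (A₂ * A₂)).IsHermitian :=
      hK₁h.sub (isHermitian_real_smul (isHermitian_mul_self' hA₂) V⁻¹)
    have h := log_partitionFn_sub_log_partitionFn_le hHmh hH₂h hβ.le
    have hdiff : K₁ - ((V⁻¹ : ℝ) : ℂ) • (A₂ * A₂) -
        (T - ((V⁻¹ : ℝ) : ℂ) • (A₁ * A₁ + A₂ * A₂ + Complex.I • ⁅A₁, A₂⁆)) =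
        ((V⁻¹ : ℝ) : ℂ) • (Complex.I • ⁅A₁, A₂⁆) := by
      rw [hK₁]
      simp only [smul_add]
      abel
    have hn : ‖K₁ - ((V⁻¹ : ℝ) : ℂ) • (A₂ * A₂) -
        (T - ((V⁻¹ : ℝ) : ℂ) • (A₁ * A₁ + A₂ * A₂ + Complex.I • ⁅A₁, A₂⁆))‖ ≤ C₂ := by
      rw [hdiff, norm_smul, norm_smul, Complex.norm_I, one_mul, hvn]
      calc V⁻¹ * ‖⁅A₁, A₂⁆‖ ≤ V⁻¹ * (C₂ * V) :=
            mul_le_mul_of_nonneg_left h12 (inv_nonneg.2 hV.le)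
        _ = C₂ := by field_simp
    have := mul_le_mul_of_nonneg_left hn hβ.le
    linarith
  -- step 1: channel `A₂`, kinetic part `K₁`
  have hκ₁ : ‖⁅A₂, ⁅A₂, K₁⁆⁆‖ ≤ (κT + 2 * κA * C + 2 * C₂ ^ 2) * V := by
    have hsplit : ⁅A₂, ⁅A₂, K₁⁆⁆ =
        ⁅A₂, ⁅A₂, T⁆⁆ - ((V⁻¹ : ℝ) : ℂ) • ⁅A₂, ⁅A₂, A₁ * A₁⁆⁆ := by
      rw [hK₁]
      simp only [Ring.lie_def, Matrix.mul_sub, Matrix.sub_mul, Matrix.mul_smul, Matrix.smul_mul,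
        smul_sub, Matrix.mul_assoc]
      module
    have h21 : ‖⁅A₂, A₁⁆‖ ≤ C₂ * V := by
      rw [show ⁅A₂, A₁⁆ = -⁅A₁, A₂⁆ by simp only [Ring.lie_def]; exact (neg_sub _ _).symm,
        norm_neg]
      exact h12
    have hb : ‖⁅A₂, ⁅A₂, A₁ * A₁⁆⁆‖ ≤ (2 * κA * C + 2 * C₂ ^ 2) * V ^ 2 := by
      refine (norm_lie_lie_mul_self_le A₂ A₁).trans ?_
      have i1 : ‖⁅A₂, ⁅A₂, A₁⁆⁆‖ * ‖A₁‖ ≤ (κA * V) * (C * V) :=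
        mul_le_mul hA21 hn1 (norm_nonneg _) (mul_nonneg hκA0 hV.le)
      have i2 : ‖⁅A₂, A₁⁆‖ ^ 2 ≤ (C₂ * V) ^ 2 := pow_le_pow_left₀ (norm_nonneg _) h21 2
      nlinarith [i1, i2]
    rw [hsplit]
    calc ‖⁅A₂, ⁅A₂, T⁆⁆ - ((V⁻¹ : ℝ) : ℂ) • ⁅A₂, ⁅A₂, A₁ * A₁⁆⁆‖
        ≤ ‖⁅A₂, ⁅A₂, T⁆⁆‖ + ‖((V⁻¹ : ℝ) : ℂ) • ⁅A₂, ⁅A₂, A₁ * A₁⁆⁆‖ := norm_sub_le _ _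
      _ ≤ κT * V + V⁻¹ * ((2 * κA * C + 2 * C₂ ^ 2) * V ^ 2) := by
          rw [norm_smul, hvn]
          exact add_le_add hT2 (mul_le_mul_of_nonneg_left hb (inv_nonneg.2 hV.le))
      _ = (κT + 2 * κA * C + 2 * C₂ ^ 2) * V := by
          field_simp
          ring
  obtain ⟨y, hy, hstep1⟩ := log_partitionFn_oneChannel_le hK₁h hA₂ hβ hV hr hn2 hκ₁
  -- step 2: channel `A₁`, kinetic part `K₂ = T - 2yA₂`
  set K₂ : Matrix n n ℂ := T - ((2 * y : ℝ) : ℂ) • A₂ with hK₂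
  have hK₂h : K₂.IsHermitian := isHermitian_sub_smul hT hA₂ _
  have hκ₂ : ‖⁅A₁, ⁅A₁, K₂⁆⁆‖ ≤ (κT + 2 * C * κA) * V := by
    have hsplit : ⁅A₁, ⁅A₁, K₂⁆⁆ =
        ⁅A₁, ⁅A₁, T⁆⁆ - ((2 * y : ℝ) : ℂ) • ⁅A₁, ⁅A₁, A₂⁆⁆ := by
      rw [hK₂]
      simp only [Ring.lie_def, Matrix.mul_sub, Matrix.sub_mul, Matrix.mul_smul, Matrix.smul_mul,
        smul_sub, Matrix.mul_assoc]
      module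
    rw [hsplit]
    calc ‖⁅A₁, ⁅A₁, T⁆⁆ - ((2 * y : ℝ) : ℂ) • ⁅A₁, ⁅A₁, A₂⁆⁆‖
        ≤ ‖⁅A₁, ⁅A₁, T⁆⁆‖ + ‖((2 * y : ℝ) : ℂ) • ⁅A₁, ⁅A₁, A₂⁆⁆‖ := norm_sub_le _ _
      _ ≤ κT * V + (2 * C) * (κA * V) := by
          rw [norm_smul, Complex.norm_real, Real.norm_eq_abs, abs_mul, abs_of_pos two_pos]
          exact add_le_add hT1 (mul_le_mul (mul_le_mul_of_nonneg_left hy two_pos.le) hA12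
            (norm_nonneg _) (mul_nonneg two_pos.le hC0))
      _ = (κT + 2 * C * κA) * V := by ring
  obtain ⟨x, hx, hstep2⟩ := log_partitionFn_oneChannel_le hK₂h hA₁ hβ hV hr hn1 hκ₂
  refine ⟨x, y, ?_⟩
  have e1 : K₁ - ((2 * y : ℝ) : ℂ) • A₂ = K₂ - ((V⁻¹ : ℝ) : ℂ) • (A₁ * A₁) := by
    rw [hK₁, hK₂, sub_right_comm]
  have e2 : K₂ - ((2 * x : ℝ) : ℂ) • A₁ =
      T - ((2 * x : ℝ) : ℂ) • A₁ - ((2 * y : ℝ) : ℂ) • A₂ := by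
    rw [hK₂, sub_right_comm]
  rw [e1] at hstep1
  rw [e2] at hstep2
  have key : ∀ L M₁ M₂ R E₁ E₂ P Q S : ℝ, L ≤ M₁ + S → M₁ ≤ M₂ - P + E₁ → M₂ ≤ R - Q + E₂ →
      L ≤ R - (Q + P) + (S + (E₁ + E₂)) := by
    intros; linarith
  refine (key _ _ _ _ _ _ _ _ _ h0 hstep1 hstep2).trans (le_of_eq ?_)
  ring

end TwoChannel

/-! ### From one complex channel `U` to the Hermitian pair `(U + U⋆)/2`, `i(U⋆ - U)/2` -/

section Translation

variable {T : Matrix n n ℂ} (U : Matrix n n ℂ)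

omit [Fintype n] [DecidableEq n] in
/-- `(U + U⋆)/2` is Hermitian. [folklore] -/
theorem isHermitian_rePart : ((2⁻¹ : ℂ) • (U + Uᴴ)).IsHermitian := by
  rw [IsHermitian, conjTranspose_smul, conjTranspose_add, conjTranspose_conjTranspose, add_comm]
  congr 1
  simp

omit [Fintype n] [DecidableEq n] in
/-- `i(U⋆ - U)/2` is Hermitian. [folklore] -/
theorem isHermitian_imPart : (((2⁻¹ : ℂ) * Complex.I) • (Uᴴ - U)).IsHermitian := by
  rw [IsHermitian, conjTranspose_smul, conjTranspose_sub, conjTranspose_conjTranspose]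
  rw [show star ((2⁻¹ : ℂ) * Complex.I) = -((2⁻¹ : ℂ) * Complex.I) by
    simp [Complex.conj_I]]
  rw [neg_smul, ← smul_neg, neg_sub]

/-- **`U⋆U = A₁² + A₂² + i[A₁, A₂]`** for `A₁ = (U + U⋆)/2`, `A₂ = i(U⋆ - U)/2`. [folklore] -/
theorem conjTranspose_mul_self_eq_reIm :
    Uᴴ * U = ((2⁻¹ : ℂ) • (U + Uᴴ)) * ((2⁻¹ : ℂ) • (U + Uᴴ)) +
      (((2⁻¹ : ℂ) * Complex.I) • (Uᴴ - U)) * (((2⁻¹ : ℂ) * Complex.I) • (Uᴴ - U)) +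
      Complex.I • ⁅(2⁻¹ : ℂ) • (U + Uᴴ), ((2⁻¹ : ℂ) * Complex.I) • (Uᴴ - U)⁆ := by
  simp only [Ring.lie_def, smul_mul_smul_comm, smul_sub, smul_smul, Matrix.mul_add,
    Matrix.add_mul, Matrix.mul_sub, Matrix.sub_mul, smul_add]
  match_scalars <;> norm_num [Complex.ext_iff]

omit [Fintype n] [DecidableEq n] in
/-- **The approximating Hamiltonian in the Hermitian pair**: for `c = x + iy`,
`c̄ U + c U⋆ = 2x A₁ + 2y A₂`. [folklore] -/
theorem conj_smul_add_smul_conjTranspose (x y : ℝ) :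
    (starRingEnd ℂ ((x : ℂ) + (y : ℂ) * Complex.I)) • U + ((x : ℂ) + (y : ℂ) * Complex.I) • Uᴴ =
      ((2 * x : ℝ) : ℂ) • ((2⁻¹ : ℂ) • (U + Uᴴ)) +
        ((2 * y : ℝ) : ℂ) • (((2⁻¹ : ℂ) * Complex.I) • (Uᴴ - U)) := by
  simp only [map_add, map_mul, Complex.conj_ofReal, Complex.conj_I, smul_smul, smul_add, smul_sub]
  push_cast
  module

/-- `‖(U + U⋆)/2‖ ≤ ‖U‖`. [folklore] -/
theorem norm_rePart_le : ‖(2⁻¹ : ℂ) • (U + Uᴴ)‖ ≤ ‖U‖ := by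
  rw [norm_smul, norm_inv, Complex.norm_two]
  have h := norm_add_le U Uᴴ
  rw [l2_opNorm_conjTranspose] at h
  linarith

/-- `‖i(U⋆ - U)/2‖ ≤ ‖U‖`. [folklore] -/
theorem norm_imPart_le : ‖((2⁻¹ : ℂ) * Complex.I) • (Uᴴ - U)‖ ≤ ‖U‖ := by
  rw [norm_smul, norm_mul, norm_inv, Complex.norm_two, Complex.norm_I, mul_one]
  have h := norm_sub_le Uᴴ U
  rw [l2_opNorm_conjTranspose] at h
  linarith

/-- `[A₁, A₂] = (i/2) [U, U⋆]`. [folklore] -/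
theorem lie_rePart_imPart :
    ⁅(2⁻¹ : ℂ) • (U + Uᴴ), ((2⁻¹ : ℂ) * Complex.I) • (Uᴴ - U)⁆ =
      ((2⁻¹ : ℂ) * Complex.I) • (U * Uᴴ - Uᴴ * U) := by
  simp only [Ring.lie_def, smul_mul_smul_comm, Matrix.mul_add, Matrix.add_mul, Matrix.mul_sub,
    Matrix.sub_mul, smul_add, smul_sub]
  module

/-- `‖[A₁, A₂]‖ = ½ ‖[U, U⋆]‖`. [folklore] -/
theorem norm_lie_rePart_imPart :
    ‖⁅(2⁻¹ : ℂ) • (U + Uᴴ), ((2⁻¹ : ℂ) * Complex.I) • (Uᴴ - U)⁆‖ = 2⁻¹ * ‖U * Uᴴ - Uᴴ * U‖ := by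
  rw [lie_rePart_imPart, norm_smul, norm_mul, norm_inv, Complex.norm_two, Complex.norm_I, mul_one]

omit [DecidableEq n] in
/-- Adjoints of double commutators with a Hermitian `T`: `[X, [Y, T]]⋆ = [X⋆, [Y⋆, T]]`.
[folklore] -/
theorem conjTranspose_lie_lie (X Y : Matrix n n ℂ) (hT : T.IsHermitian) :
    (⁅X, ⁅Y, T⁆⁆)ᴴ = ⁅Xᴴ, ⁅Yᴴ, T⁆⁆ := by
  simp only [Ring.lie_def, conjTranspose_sub, conjTranspose_mul, hT.eq]
  noncomm_ring

omit [DecidableEq n] in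
/-- `[A₁, [A₁, T]]` in terms of `U`:
`¼ ([U,[U,T]] + [U,[U⋆,T]] + [U⋆,[U,T]] + [U⋆,[U⋆,T]])`. [folklore] -/
theorem lie_rePart_lie_rePart (T : Matrix n n ℂ) :
    ⁅(2⁻¹ : ℂ) • (U + Uᴴ), ⁅(2⁻¹ : ℂ) • (U + Uᴴ), T⁆⁆ =
      ((2⁻¹ : ℂ) * 2⁻¹) • (⁅U, ⁅U, T⁆⁆ + ⁅U, ⁅Uᴴ, T⁆⁆ + ⁅Uᴴ, ⁅U, T⁆⁆ + ⁅Uᴴ, ⁅Uᴴ, T⁆⁆) := by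
  simp only [Ring.lie_def, Matrix.smul_mul, Matrix.mul_smul, Matrix.mul_add, Matrix.add_mul,
    Matrix.mul_sub, Matrix.sub_mul, smul_add, smul_sub, smul_smul, Matrix.mul_assoc]
  module

omit [DecidableEq n] in
/-- `[A₂, [A₂, T]]` in terms of `U`: `(i/2)² ([U⋆,[U⋆,T]] - [U⋆,[U,T]] - [U,[U⋆,T]] + [U,[U,T]])`.
[folklore] -/
theorem lie_imPart_lie_imPart (T : Matrix n n ℂ) :
    ⁅((2⁻¹ : ℂ) * Complex.I) • (Uᴴ - U), ⁅((2⁻¹ : ℂ) * Complex.I) • (Uᴴ - U), T⁆⁆ =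
      ((2⁻¹ : ℂ) * Complex.I * ((2⁻¹ : ℂ) * Complex.I)) •
        (⁅Uᴴ, ⁅Uᴴ, T⁆⁆ - ⁅Uᴴ, ⁅U, T⁆⁆ - ⁅U, ⁅Uᴴ, T⁆⁆ + ⁅U, ⁅U, T⁆⁆) := by
  simp only [Ring.lie_def, Matrix.smul_mul, Matrix.mul_smul,
    Matrix.mul_sub, Matrix.sub_mul, smul_add, smul_sub, smul_smul, Matrix.mul_assoc]
  module

omit [DecidableEq n] in
/-- `[A₁, [A₁, A₂]]` in terms of `U`: `-(i/4) ([U,[U⋆,U]] + [U⋆,[U⋆,U]])`. [folklore] -/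
theorem lie_rePart_lie_rePart_imPart :
    ⁅(2⁻¹ : ℂ) • (U + Uᴴ), ⁅(2⁻¹ : ℂ) • (U + Uᴴ), ((2⁻¹ : ℂ) * Complex.I) • (Uᴴ - U)⁆⁆ =
      (-((2⁻¹ : ℂ) * ((2⁻¹ : ℂ) * Complex.I))) • (⁅U, ⁅Uᴴ, U⁆⁆ + ⁅Uᴴ, ⁅Uᴴ, U⁆⁆) := by
  simp only [Ring.lie_def, Matrix.smul_mul, Matrix.mul_smul, Matrix.mul_add, Matrix.add_mul,
    Matrix.mul_sub, Matrix.sub_mul, smul_add, smul_sub, smul_smul, Matrix.mul_assoc, neg_smul]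
  module

omit [DecidableEq n] in
/-- `[A₂, [A₂, A₁]]` in terms of `U`: `(i/2)² ([U⋆,[U⋆,U]] - [U,[U⋆,U]])`. [folklore] -/
theorem lie_imPart_lie_imPart_rePart :
    ⁅((2⁻¹ : ℂ) * Complex.I) • (Uᴴ - U),
        ⁅((2⁻¹ : ℂ) * Complex.I) • (Uᴴ - U), (2⁻¹ : ℂ) • (U + Uᴴ)⁆⁆ =
      ((2⁻¹ : ℂ) * Complex.I * ((2⁻¹ : ℂ) * Complex.I)) • (⁅Uᴴ, ⁅Uᴴ, U⁆⁆ - ⁅U, ⁅Uᴴ, U⁆⁆) := by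
  simp only [Ring.lie_def, Matrix.smul_mul, Matrix.mul_smul, Matrix.mul_add, Matrix.add_mul,
    Matrix.mul_sub, Matrix.sub_mul, smul_add, smul_sub, smul_smul, Matrix.mul_assoc]
  module

/-- **Condition (A3), commutators with the kinetic part, in the Hermitian pair**: if `T` is
Hermitian and `‖[U,[U,T]]‖, ‖[U⋆,[U,T]]‖ ≤ c`, then `‖[A_j,[A_j,T]]‖ ≤ c` for `j = 1, 2`
(`[U⋆,[U⋆,T]] = [U,[U,T]]⋆`, `[U,[U⋆,T]] = [U⋆,[U,T]]⋆`). [folklore] -/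
theorem norm_lie_lie_rePart_imPart_le (hT : T.IsHermitian) {c : ℝ} (h1 : ‖⁅U, ⁅U, T⁆⁆‖ ≤ c)
    (h2 : ‖⁅Uᴴ, ⁅U, T⁆⁆‖ ≤ c) :
    ‖⁅(2⁻¹ : ℂ) • (U + Uᴴ), ⁅(2⁻¹ : ℂ) • (U + Uᴴ), T⁆⁆‖ ≤ c ∧
      ‖⁅((2⁻¹ : ℂ) * Complex.I) • (Uᴴ - U), ⁅((2⁻¹ : ℂ) * Complex.I) • (Uᴴ - U), T⁆⁆‖ ≤ c := by
  have h3 : ‖⁅Uᴴ, ⁅Uᴴ, T⁆⁆‖ ≤ c := by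
    rw [← conjTranspose_lie_lie U U hT, l2_opNorm_conjTranspose]
    exact h1
  have h4 : ‖⁅U, ⁅Uᴴ, T⁆⁆‖ ≤ c := by
    have h := conjTranspose_lie_lie Uᴴ U hT
    rw [conjTranspose_conjTranspose] at h
    rw [← h, l2_opNorm_conjTranspose]
    exact h2
  have hq : ‖(2⁻¹ : ℂ) * 2⁻¹‖ = 4⁻¹ := by norm_num
  have hq' : ‖(2⁻¹ : ℂ) * Complex.I * ((2⁻¹ : ℂ) * Complex.I)‖ = 4⁻¹ := by
    simp only [norm_mul, norm_inv, Complex.norm_two, Complex.norm_I]; norm_num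
  constructor
  · rw [lie_rePart_lie_rePart, norm_smul, hq]
    have := norm_add_le (⁅U, ⁅U, T⁆⁆ + ⁅U, ⁅Uᴴ, T⁆⁆ + ⁅Uᴴ, ⁅U, T⁆⁆) ⁅Uᴴ, ⁅Uᴴ, T⁆⁆
    have := norm_add₃_le (a := ⁅U, ⁅U, T⁆⁆) (b := ⁅U, ⁅Uᴴ, T⁆⁆) (c := ⁅Uᴴ, ⁅U, T⁆⁆)
    linarith
  · rw [lie_imPart_lie_imPart, norm_smul, hq']
    have e1 := norm_add_le (⁅Uᴴ, ⁅Uᴴ, T⁆⁆ - ⁅Uᴴ, ⁅U, T⁆⁆ - ⁅U, ⁅Uᴴ, T⁆⁆) ⁅U, ⁅U, T⁆⁆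
    have e2 := norm_sub_le (⁅Uᴴ, ⁅Uᴴ, T⁆⁆ - ⁅Uᴴ, ⁅U, T⁆⁆) ⁅U, ⁅Uᴴ, T⁆⁆
    have e3 := norm_sub_le ⁅Uᴴ, ⁅Uᴴ, T⁆⁆ ⁅Uᴴ, ⁅U, T⁆⁆
    linarith

/-- **Condition (A3), commutators within the channel, in the Hermitian pair**: if
`‖[U,[U⋆,U]]‖, ‖[U⋆,[U⋆,U]]‖ ≤ c` then `‖[A₁,[A₁,A₂]]‖, ‖[A₂,[A₂,A₁]]‖ ≤ c/2`. [folklore] -/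
theorem norm_lie_lie_rePart_imPart_cross_le {c : ℝ} (h1 : ‖⁅U, ⁅Uᴴ, U⁆⁆‖ ≤ c)
    (h2 : ‖⁅Uᴴ, ⁅Uᴴ, U⁆⁆‖ ≤ c) :
    ‖⁅(2⁻¹ : ℂ) • (U + Uᴴ), ⁅(2⁻¹ : ℂ) • (U + Uᴴ), ((2⁻¹ : ℂ) * Complex.I) • (Uᴴ - U)⁆⁆‖ ≤
        c / 2 ∧
      ‖⁅((2⁻¹ : ℂ) * Complex.I) • (Uᴴ - U),
        ⁅((2⁻¹ : ℂ) * Complex.I) • (Uᴴ - U), (2⁻¹ : ℂ) • (U + Uᴴ)⁆⁆‖ ≤ c / 2 := by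
  have hq : ‖-((2⁻¹ : ℂ) * ((2⁻¹ : ℂ) * Complex.I))‖ = 4⁻¹ := by
    simp only [norm_neg, norm_mul, norm_inv, Complex.norm_two, Complex.norm_I]; norm_num
  have hq' : ‖(2⁻¹ : ℂ) * Complex.I * ((2⁻¹ : ℂ) * Complex.I)‖ = 4⁻¹ := by
    simp only [norm_mul, norm_inv, Complex.norm_two, Complex.norm_I]; norm_num
  constructor
  · rw [lie_rePart_lie_rePart_imPart, norm_smul, hq]
    have := norm_add_le ⁅U, ⁅Uᴴ, U⁆⁆ ⁅Uᴴ, ⁅Uᴴ, U⁆⁆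
    linarith
  · rw [lie_imPart_lie_imPart_rePart, norm_smul, hq']
    have := norm_sub_le ⁅Uᴴ, ⁅Uᴴ, U⁆⁆ ⁅U, ⁅Uᴴ, U⁆⁆
    linarith

end Translation

/-! ### Assembly: Theorem 107 for one attractive complex channel -/

section Assembly

variable {T : Matrix n n ℂ}

/-- Completing the square on the attractive side (abstract scalars `v`, `w`):
`T - (v w̄ U + v w U⋆) + v w̄ w - (T - v U⋆U) = v (U - w)⋆(U - w)`. [folklore] -/
theorem approx_add_sub_model_aux (T U : Matrix n n ℂ) (v w : ℂ) :
    T - ((v * star w) • U + (v * w) • Uᴴ) + (v * (star w * w)) • 1 - (T - v • (Uᴴ * U)) =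
      v • ((U - w • 1)ᴴ * (U - w • 1)) := by
  simp only [conjTranspose_sub, conjTranspose_smul, conjTranspose_one, Matrix.sub_mul,
    Matrix.mul_sub, Matrix.smul_mul, Matrix.mul_smul, Matrix.one_mul, Matrix.mul_one, smul_sub,
    smul_smul]
  module

omit [Fintype n] [DecidableEq n] in
/-- `c̄ U + c U⋆` is Hermitian. [folklore] -/
theorem isHermitian_conj_smul_add_smul_conjTranspose (U : Matrix n n ℂ) (c : ℂ) :
    (starRingEnd ℂ c • U + c • Uᴴ).IsHermitian := by
  rw [IsHermitian, conjTranspose_add, conjTranspose_smul, conjTranspose_smul,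
    conjTranspose_conjTranspose, add_comm]
  simp

/-- **Theorem 107, lower bound (attractive channel)**: for every `c ∈ ℂ`,
`log Z(T - (c̄U + cU⋆)) - βV|c|² ≤ log Z(T - V⁻¹U⋆U)`, because
`H_Λ(c) + |c|²V - H_Λ = V⁻¹(U - cV)⋆(U - cV) ≥ 0` and the free energy is monotone.
[cite: BruPedra2013, Appendix: The approximating Hamiltonian method, Theorem 107] -/
theorem log_partitionFn_approx_le_model (hT : T.IsHermitian) (U : Matrix n n ℂ) [Nonempty n]
    {β V : ℝ} (hβ : 0 ≤ β) (hV : 0 < V) (c : ℂ) :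
    Real.log (partitionFn β (T - (starRingEnd ℂ c • U + c • Uᴴ))).re - β * V * ‖c‖ ^ 2 ≤
      Real.log (partitionFn β (T - ((V⁻¹ : ℝ) : ℂ) • (Uᴴ * U))).re := by
  have hV0 : (V : ℂ) ≠ 0 := by exact_mod_cast hV.ne'
  have hAp : (T - (starRingEnd ℂ c • U + c • Uᴴ)).IsHermitian :=
    hT.sub (isHermitian_conj_smul_add_smul_conjTranspose U c)
  have hApk : (T - (starRingEnd ℂ c • U + c • Uᴴ) + ((‖c‖ ^ 2 * V : ℝ) : ℂ) • 1).IsHermitian :=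
    hAp.add (isHermitian_real_smul isHermitian_one _)
  have hM : (T - ((V⁻¹ : ℝ) : ℂ) • (Uᴴ * U)).IsHermitian :=
    hT.sub (isHermitian_real_smul (posSemidef_conjTranspose_mul_self U).isHermitian V⁻¹)
  -- the completed square
  have hsq : T - (starRingEnd ℂ c • U + c • Uᴴ) + ((‖c‖ ^ 2 * V : ℝ) : ℂ) • 1 -
      (T - ((V⁻¹ : ℝ) : ℂ) • (Uᴴ * U)) =
      ((V⁻¹ : ℝ) : ℂ) • ((U - (c * V) • 1)ᴴ * (U - (c * V) • 1)) := by
    have e1 : starRingEnd ℂ c = ((V⁻¹ : ℝ) : ℂ) * star (c * (V : ℂ)) := by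
      rw [Complex.star_def, map_mul, Complex.conj_ofReal]; push_cast; field_simp
    have e2 : ((V⁻¹ : ℝ) : ℂ) * (c * (V : ℂ)) = c := by push_cast; field_simp
    have e3 : ((‖c‖ ^ 2 * V : ℝ) : ℂ) = ((V⁻¹ : ℝ) : ℂ) * (star (c * (V : ℂ)) * (c * (V : ℂ))) := by
      rw [Complex.star_def, Complex.conj_mul', Complex.norm_mul, Complex.norm_real,
        Real.norm_of_nonneg hV.le]
      push_cast
      field_simp
    have h := approx_add_sub_model_aux T U ((V⁻¹ : ℝ) : ℂ) (c * V)
    rw [← e1, e2, ← e3] at h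
    exact h
  have hpsd : (T - (starRingEnd ℂ c • U + c • Uᴴ) + ((‖c‖ ^ 2 * V : ℝ) : ℂ) • 1 -
      (T - ((V⁻¹ : ℝ) : ℂ) • (Uᴴ * U))).PosSemidef := by
    rw [hsq]
    exact (posSemidef_conjTranspose_mul_self _).smul
      (Complex.zero_le_real.2 (inv_nonneg.2 hV.le))
  have hmono := log_partitionFn_le_of_posSemidef hM hApk hβ hpsd
  rw [log_partitionFn_add_smul_one hAp] at hmono
  have : β * (‖c‖ ^ 2 * V) = β * V * ‖c‖ ^ 2 := by ring
  linarith

/-- **Theorem 107 (i), attractive channel**: the approximating free energy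
`c ↦ |c|² - p[T - (c̄U + cU⋆)]` attains its infimum on `ℂ` (equivalently `p[H(c)] - |c|²`
attains its supremum): it is continuous and `p[H(c)] ≤ p[T] + 2|c| ‖U‖/V` (Lipschitz bound), so
a maximiser over a large closed disc is a global maximiser.
[cite: BruPedra2013, Appendix: The approximating Hamiltonian method, Theorem 107 (i)] -/
theorem exists_isMax_approx (hT : T.IsHermitian) (U : Matrix n n ℂ) [Nonempty n] {β V : ℝ}
    (hβ : 0 < β) (hV : 0 < V) :
    ∃ d₀ : ℂ, ∀ c : ℂ,
      Real.log (partitionFn β (T - (starRingEnd ℂ c • U + c • Uᴴ))).re / (β * V) - ‖c‖ ^ 2 ≤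
        Real.log (partitionFn β (T - (starRingEnd ℂ d₀ • U + d₀ • Uᴴ))).re / (β * V) -
          ‖d₀‖ ^ 2 := by
  set F : ℂ → ℝ := fun c =>
    Real.log (partitionFn β (T - (starRingEnd ℂ c • U + c • Uᴴ))).re / (β * V) - ‖c‖ ^ 2
    with hF
  have hAp : ∀ c : ℂ, (T - (starRingEnd ℂ c • U + c • Uᴴ)).IsHermitian := fun c =>
    hT.sub (isHermitian_conj_smul_add_smul_conjTranspose U c)
  -- continuity
  have hcont : Continuous F := by
    letI : NormedAlgebra ℚ (Matrix n n ℂ) := .restrictScalars ℚ ℂ _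
    have h1 : Continuous fun c : ℂ => T - (starRingEnd ℂ c • U + c • Uᴴ) :=
      continuous_const.sub ((Complex.continuous_conj.smul continuous_const).add
        (continuous_id.smul continuous_const))
    have h2 : Continuous fun c : ℂ =>
        (partitionFn β (T - (starRingEnd ℂ c • U + c • Uᴴ))).re := by
      have h3 : Continuous fun c : ℂ =>
          exp (-(β : ℂ) • (T - (starRingEnd ℂ c • U + c • Uᴴ))) :=
        NormedSpace.exp_continuous.comp (h1.const_smul (-(β : ℂ)))
      exact Complex.continuous_re.comp h3.matrix_trace
    have h4 : Continuous fun c : ℂ =>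
        Real.log (partitionFn β (T - (starRingEnd ℂ c • U + c • Uᴴ))).re :=
      h2.log fun c => (partitionFn_re_pos (hAp c) β).ne'
    exact (h4.div_const _).sub (continuous_norm.pow 2)
  -- coercivity
  have hβV : 0 < β * V := mul_pos hβ hV
  have hcoer : ∀ c : ℂ, F c ≤ F 0 + 2 * ‖U‖ / V * ‖c‖ - ‖c‖ ^ 2 := by
    intro c
    have hL := log_partitionFn_sub_log_partitionFn_le (hAp c) hT hβ.le
    have hn : ‖T - (T - (starRingEnd ℂ c • U + c • Uᴴ))‖ ≤ 2 * ‖c‖ * ‖U‖ := by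
      rw [sub_sub_cancel]
      refine (norm_add_le _ _).trans ?_
      rw [norm_smul, norm_smul, l2_opNorm_conjTranspose, Complex.norm_conj]
      linarith
    have hF0 : F 0 = Real.log (partitionFn β T).re / (β * V) := by
      simp [hF]
    have hFc : F c = Real.log (partitionFn β (T - (starRingEnd ℂ c • U + c • Uᴴ))).re / (β * V) -
        ‖c‖ ^ 2 := rfl
    rw [hF0, hFc]
    have key : Real.log (partitionFn β (T - (starRingEnd ℂ c • U + c • Uᴴ))).re ≤
        Real.log (partitionFn β T).re + β * (2 * ‖c‖ * ‖U‖) := by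
      have := mul_le_mul_of_nonneg_left hn hβ.le
      linarith
    have hdiv := div_le_div_of_nonneg_right key hβV.le
    have e : (Real.log (partitionFn β T).re + β * (2 * ‖c‖ * ‖U‖)) / (β * V) =
        Real.log (partitionFn β T).re / (β * V) + 2 * ‖U‖ / V * ‖c‖ := by
      field_simp
    rw [e] at hdiv
    linarith
  -- a maximiser on a large disc is a global maximiser
  set R : ℝ := 2 * ‖U‖ / V + 1 with hR
  have hR0 : 0 < R := by positivity
  obtain ⟨d₀, -, hmax⟩ := (isCompact_closedBall (0 : ℂ) R).exists_isMaxOn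
    ⟨0, Metric.mem_closedBall_self hR0.le⟩ hcont.continuousOn
  have h0 : F 0 ≤ F d₀ := hmax (Metric.mem_closedBall_self hR0.le)
  refine ⟨d₀, fun c => ?_⟩
  show F c ≤ F d₀
  by_cases hc : ‖c‖ ≤ R
  · exact hmax (mem_closedBall_zero_iff.2 hc)
  · push Not at hc
    have h1 : 2 * ‖U‖ / V * ‖c‖ - ‖c‖ ^ 2 ≤ 0 := by
      have : 2 * ‖U‖ / V ≤ ‖c‖ - 1 := by rw [hR] at hc; linarith
      nlinarith [norm_nonneg c]
    linarith [hcoer c]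

/-- **Theorem 107 (ii), upper bound, attractive channel — quantitative finite-volume form**:
under (A2) `‖U‖ ≤ C₁V` and (A3) `‖[U,U⋆]‖ ≤ VC₂`, `‖[U,[U⋆,U]]‖, ‖[U⋆,[U⋆,U]]‖ ≤ VC₃`,
`‖[U,[U,T]]‖, ‖[U⋆,[U,T]]‖ ≤ VC₄`, for every `r > 0` there is `c ∈ ℂ` with
`p[T - V⁻¹U⋆U] ≤ p[T - (c̄U + cU⋆)] - |c|² + 4rC₁ + Q(r)/V`,
`Q(r) = C₂/2 + 2C₁/(βr) + ½(√(C₁κ₁/r) + √(C₁κ₂/r))`, `κ₁ = C₄ + C₁C₃ + C₂²/2`,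
`κ₂ = C₄ + C₁C₃` (two applications of Bogoliubov Jr.'s one-channel estimate to the Hermitian
pair `(U + U⋆)/2`, `i(U⋆ - U)/2`).
[cite: BruPedra2013, Appendix: The approximating Hamiltonian method, Theorem 107 (ii)]
[cite: BogolyubovJrEtAl1984, approximating Hamiltonian method (attraction; via BruPedra2013)] -/
theorem exists_pressure_model_le (hT : T.IsHermitian) (U : Matrix n n ℂ) [Nonempty n]
    {β V r C₁ C₂ C₃ C₄ : ℝ} (hβ : 0 < β) (hV : 0 < V) (hr : 0 < r)
    (hU : ‖U‖ ≤ C₁ * V) (h2 : ‖U * Uᴴ - Uᴴ * U‖ ≤ V * C₂)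
    (h3a : ‖⁅U, ⁅Uᴴ, U⁆⁆‖ ≤ V * C₃) (h3b : ‖⁅Uᴴ, ⁅Uᴴ, U⁆⁆‖ ≤ V * C₃)
    (h4a : ‖⁅U, ⁅U, T⁆⁆‖ ≤ V * C₄) (h4b : ‖⁅Uᴴ, ⁅U, T⁆⁆‖ ≤ V * C₄) :
    ∃ c : ℂ, Real.log (partitionFn β (T - ((V⁻¹ : ℝ) : ℂ) • (Uᴴ * U))).re / (β * V) ≤
      Real.log (partitionFn β (T - (starRingEnd ℂ c • U + c • Uᴴ))).re / (β * V) - ‖c‖ ^ 2 +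
        (4 * r * C₁ + (C₂ / 2 + 2 * C₁ / (β * r) +
          (Real.sqrt (C₁ * (C₄ + 2 * (C₃ / 2) * C₁ + 2 * (C₂ / 2) ^ 2) / r) +
            Real.sqrt (C₁ * (C₄ + 2 * C₁ * (C₃ / 2)) / r)) / 2) / V) := by
  have hβ0 : β ≠ 0 := hβ.ne'
  have hV0 : V ≠ 0 := hV.ne'
  have hTT := norm_lie_lie_rePart_imPart_le U hT (c := C₄ * V) (by linarith) (by linarith)
  have hAA := norm_lie_lie_rePart_imPart_cross_le U (c := C₃ * V) (by linarith) (by linarith)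
  obtain ⟨x, y, hxy⟩ := log_partitionFn_twoChannel_le hT (isHermitian_rePart U)
    (isHermitian_imPart U) hβ hV hr (C := C₁) (C₂ := C₂ / 2) (κT := C₄) (κA := C₃ / 2)
    ((norm_rePart_le U).trans hU) ((norm_imPart_le U).trans hU)
    (by rw [norm_lie_rePart_imPart]; linarith) hTT.1 hTT.2 (by linarith [hAA.1])
    (by linarith [hAA.2])
  refine ⟨(x : ℂ) + (y : ℂ) * Complex.I, ?_⟩
  rw [← conjTranspose_mul_self_eq_reIm] at hxy
  rw [conj_smul_add_smul_conjTranspose, ← sub_sub, Complex.sq_norm, Complex.normSq_add_mul_I]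
  have hdiv := div_le_div_of_nonneg_right hxy (mul_pos hβ hV).le
  refine hdiv.trans (le_of_eq ?_)
  field_simp
  ring

end Assembly

/-! ### Discharge of the named fact -/

/-- **Discharge of `bogoliubovJr_approximatingHamiltonian_attractive`** (Bogolyubov Jr.–Brankov–
Zagrebnov–Kurbatov–Tonchev 1984, as stated in Bru–de Siqueira Pedra, Mem. AMS 224 (2013),
Appendix "The approximating Hamiltonian method", Theorem 107 (i)–(ii) with (A1)–(A4),
specialised to one attractive channel in finite-dimensional boxes). Bru–Pedra print no proof
(they cite BBZKT 1984: "the proof uses as a key ingredient the Bogoliubov (convexity)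
inequality ... [and] the Ginibre inequalities"); the proof given here is Bogoliubov Jr.'s
majorisation method in the following finite-dimensional rendering:
(i) is continuity and coercivity of the approximating free energy (`exists_isMax_approx`);
the lower bound `p[H] ≥ p[H(c)] - |c|²` is the completed square
`H(c) + |c|²V - H = V⁻¹(U - cV)⋆(U - cV) ≥ 0` (`log_partitionFn_approx_le_model`); the upper
bound is `exists_pressure_model_le`: write `U = A₁ + iA₂` with Hermitian `A₁, A₂`, discard
`V⁻¹ i[A₁,A₂]` (norm `≤ C₂/2`), and treat the two Hermitian attractive channels successively by
Bogoliubov Jr.'s estimate `log_partitionFn_oneChannel_le` — a symmetry-breaking source `-sA`,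
`|s| < r`, chosen by the mean value theorem so that the Duhamel variance of `A` is `≤ ‖A‖/(βr)`
(the susceptibility `d⟨A⟩/ds` integrates to at most `2‖A‖`), the Bogoliubov convexity
(Peierls–Bogoliubov) inequality at the sourced Hamiltonian with the completed square
`x = ⟨A⟩/V`, and the Falk–Bruch / Bogoliubov Jr. fluctuation inequality
(`Matrix.falkBruch_sum_le`) with the double commutators of (A3); this gives
`0 ≤ p[H_l] - sup_c (p[H_l(c)] - |c|²) ≤ 4rC₁ + Q(r)/vol_l` for every `r > 0`, whence (ii) as
`vol_l → ∞`. Hypotheses (A1) and (A4) are not needed in this finite-dimensional attractive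
case (cf. Bru–Pedra, Remark 34: (A4) serves the repulsive channels).
[cite: BruPedra2013, Appendix: The approximating Hamiltonian method, Theorem 107 and (A1)–(A4)]
[cite: BogolyubovJrEtAl1984, Theorem (ii) of the approximating Hamiltonian method] -/
theorem bogoliubovJr_approximatingHamiltonian_attractive_holds :
    bogoliubovJr_approximatingHamiltonian_attractive := by
  intro d vol T U β C₀ C₁ C₂ C₃ C₄ hβ hvol hvol_top hT _hA1 hA2 hA3a hA3b hA3c _hA4
  -- the constants are nonnegative
  have hC₁ : 0 ≤ C₁ := by
    have h := (norm_nonneg (U 0)).trans (hA2 0)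
    have := hvol 0
    by_contra hc
    push Not at hc
    nlinarith
  have hC₂ : 0 ≤ C₂ := by
    have h := (norm_nonneg (U 0 * (U 0)ᴴ - (U 0)ᴴ * U 0)).trans (hA3a 0)
    have := hvol 0
    by_contra hc
    push Not at hc
    nlinarith
  -- the `V`-independent part of the error
  set Q : ℝ → ℝ := fun r => C₂ / 2 + 2 * C₁ / (β * r) +
    (Real.sqrt (C₁ * (C₄ + 2 * (C₃ / 2) * C₁ + 2 * (C₂ / 2) ^ 2) / r) +
      Real.sqrt (C₁ * (C₄ + 2 * C₁ * (C₃ / 2)) / r)) / 2 with hQ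
  have hQ0 : ∀ r, 0 < r → 0 ≤ Q r := by
    intro r hr
    simp only [hQ]
    have h1 : 0 ≤ C₂ / 2 := by linarith
    have h2 : 0 ≤ 2 * C₁ / (β * r) := by positivity
    have h3 : 0 ≤ (Real.sqrt (C₁ * (C₄ + 2 * (C₃ / 2) * C₁ + 2 * (C₂ / 2) ^ 2) / r) +
        Real.sqrt (C₁ * (C₄ + 2 * C₁ * (C₃ / 2)) / r)) / 2 := by positivity
    linarith
  -- per box: a maximiser, the lower bound, and the upper bound for every `r > 0`
  have hbox : ∀ l, ∃ d₀ : ℂ,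
      (∀ c, AHM.pressure β (vol l) (AHM.approx (T l) (U l) c) - ‖c‖ ^ 2 ≤
        AHM.pressure β (vol l) (AHM.approx (T l) (U l) d₀) - ‖d₀‖ ^ 2) ∧
      0 ≤ AHM.pressure β (vol l) (AHM.model (T l) (U l) (vol l)) -
        (AHM.pressure β (vol l) (AHM.approx (T l) (U l) d₀) - ‖d₀‖ ^ 2) ∧
      ∀ r, 0 < r → AHM.pressure β (vol l) (AHM.model (T l) (U l) (vol l)) -
        (AHM.pressure β (vol l) (AHM.approx (T l) (U l) d₀) - ‖d₀‖ ^ 2) ≤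
          4 * r * C₁ + Q r / vol l := by
    intro l
    have hV := hvol l
    rcases Nat.eq_zero_or_pos (d l) with h0 | hpos
    · -- an empty box: every pressure vanishes, the maximiser is `0`
      haveI : IsEmpty (Fin (d l)) := ⟨fun i => absurd i.2 (by omega)⟩
      have hp : ∀ H : Matrix (Fin (d l)) (Fin (d l)) ℂ, AHM.pressure β (vol l) H = 0 := by
        intro H
        simp [AHM.pressure, partitionFn, Matrix.trace]
      refine ⟨0, fun c => ?_, ?_, fun r hr => ?_⟩
      · simp only [hp, norm_zero]
        nlinarith [norm_nonneg c]
      · simp [hp]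
      · simp only [hp, norm_zero]
        have := hQ0 r hr
        have : 0 ≤ Q r / vol l := by positivity
        nlinarith
    · haveI : Nonempty (Fin (d l)) := ⟨⟨0, hpos⟩⟩
      obtain ⟨d₀, hd₀⟩ := exists_isMax_approx (hT l) (U l) hβ hV
      refine ⟨d₀, hd₀, ?_, fun r hr => ?_⟩
      · have h := log_partitionFn_approx_le_model (hT l) (U l) hβ.le hV d₀
        have hβV : 0 < β * vol l := mul_pos hβ hV
        have hdiv := div_le_div_of_nonneg_right h hβV.le
        have e : (Real.log (partitionFn β (T l - (starRingEnd ℂ d₀ • U l + d₀ • (U l)ᴴ))).re -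
            β * vol l * ‖d₀‖ ^ 2) / (β * vol l) =
            Real.log (partitionFn β (T l - (starRingEnd ℂ d₀ • U l + d₀ • (U l)ᴴ))).re /
              (β * vol l) - ‖d₀‖ ^ 2 := by
          field_simp
        rw [e] at hdiv
        dsimp only [AHM.pressure, AHM.model, AHM.approx]
        linarith
      · have h3a : ‖⁅U l, ⁅(U l)ᴴ, U l⁆⁆‖ ≤ vol l * C₃ :=
          hA3b l _ (Set.mem_insert _ _) _ (Set.mem_insert_of_mem _ (Set.mem_singleton _))
        have h3b : ‖⁅(U l)ᴴ, ⁅(U l)ᴴ, U l⁆⁆‖ ≤ vol l * C₃ :=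
          hA3b l _ (Set.mem_insert_of_mem _ (Set.mem_singleton _)) _
            (Set.mem_insert_of_mem _ (Set.mem_singleton _))
        have h4a : ‖⁅U l, ⁅U l, T l⁆⁆‖ ≤ vol l * C₄ := hA3c l _ (Set.mem_insert _ _)
        have h4b : ‖⁅(U l)ᴴ, ⁅U l, T l⁆⁆‖ ≤ vol l * C₄ :=
          hA3c l _ (Set.mem_insert_of_mem _ (Set.mem_singleton _))
        obtain ⟨c, hc⟩ := exists_pressure_model_le (hT l) (U l) hβ hV hr (hA2 l) (hA3a l)
          h3a h3b h4a h4b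
        have hmax := hd₀ c
        dsimp only [AHM.pressure, AHM.model, AHM.approx]
        simp only [hQ]
        linarith
  choose dmin hmax hlow hup using hbox
  refine ⟨dmin, hmax, ?_⟩
  -- the thermodynamic limit
  rw [Metric.tendsto_atTop]
  intro ε hε
  set r : ℝ := ε / (8 * (C₁ + 1)) with hr
  have hC1 : 0 < C₁ + 1 := by linarith
  have hrpos : 0 < r := by positivity
  have h4r : 4 * r * C₁ ≤ ε / 2 := by
    rw [hr, show 4 * (ε / (8 * (C₁ + 1))) * C₁ = ε / 2 * (C₁ / (C₁ + 1)) by field_simp; ring]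
    have h1 : C₁ / (C₁ + 1) ≤ 1 := (div_le_one hC1).2 (by linarith)
    have hε2 : 0 ≤ ε / 2 := by linarith
    calc ε / 2 * (C₁ / (C₁ + 1)) ≤ ε / 2 * 1 := mul_le_mul_of_nonneg_left h1 hε2
      _ = ε / 2 := mul_one _
  have hev : ∀ᶠ l in atTop, Q r / vol l < ε / 2 :=
    (tendsto_const_nhds.div_atTop hvol_top).eventually (gt_mem_nhds (by linarith))
  obtain ⟨N, hN⟩ := eventually_atTop.1 hev
  refine ⟨N, fun l hl => ?_⟩
  rw [Real.dist_eq, sub_zero, abs_of_nonneg (hlow l)]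
  calc _ ≤ 4 * r * C₁ + Q r / vol l := hup l r hrpos
    _ < ε / 2 + ε / 2 := add_lt_add_of_le_of_lt h4r (hN l hl)
    _ = ε := by ring

end Literature.MathematicalPhysics.QuantumLattice
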